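import Mathlib
import HarnessLib
import Summits.HubbardSuperconductivity.HubbardSuperconductivity.Theorems.WeakCouplingBCSKlCertTPrimePocketRadiusSmooth

/-!
# Route `WeakCouplingBCS` — certificate vocabulary for `WcbcsKohnLuttingerB1g` (stmt-HubbardSuperconductivity-0158):
# DOS DOMINATION — the Fermi-curve measure of the `t`–`t′` band is dominated by the push-forward of `dθ` under the polar chart (brick (N1)-3b of «TPRIME-LINDHARD-HS»)

Cell `gate-hubbard-kl`, seat margin-1 (g18), zero kit; executed for the p4 lineage's programme «TPRIME-LINDHARD-HS» (pen g27 (R468) «GO (N1)-3»: deliver the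
`hσ` SHAPE `fermiCurveMeasure ε μ ≤ ENNReal.ofReal w₁ • Measure.map γ (volume.restrict (Ioc (−π) π))` of `kltp_m03_HS_of_chart_TSL` (✓ p727153, p4 g23) /
`klg_memLp_kernel_of_geometry` (✓ p725080) with `γ` continuous).  Built on (N1)-1/2/2b/3a (`kltpPolar`, `continuous_kltpPolar`, `kltpPolarVelocity`,
`hasDerivAt_kltpPolar`, `norm_gradient_kltpPolar_pos`).  GENERIC on the Γ-window `|t′| < 1/2`, `−4 − 4t′ < μ < 4t′` (so it serves both a Γ-centred cell and,
through the particle–hole shift of p4 g19, the hole pocket of `ε_{−0.3}` at `μ ≈ −0.96` via the Γ-pocket of `ε_{+0.3}` at `−μ`); an INEQUALITY route (Lipschitz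
image), cheaper than the exact change of variables `fermiCurveMeasure_eq_map` of the `t′ = 0` tree:

* §1 **`kltp_fermiCurve_subset_image_polar`**: `F(ε_{t′}, μ) ⊆ γ((−π, π])` (`Complex.arg`/`‖·‖` polar decomposition + `kltpRadius_unique`);
* §2 `kltp_exists_speedFloor_polar` (`∃ v > 0, v ≤ ‖∇ε_{t′}‖` on `F`, by compactness from `norm_gradient_kltpPolar_pos`), `continuous_kltpPolarVelocity`,
  **`kltp_exists_lipschitzOn_polar`** (`γ` is Lipschitz on `[−π, π]`: `C¹` + `Convex.lipschitzOnWith_of_nnnorm_hasDerivWithin_le`);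
* §3 **`kltp_fermiCurveMeasure_le_map_polar`**: `∃ w₁ ≥ 0, σ[ε_{t′}, μ] ≤ ofReal w₁ • γ_*(λ⌞(−π, π])` with `w₁ = L/v`
  (`σ(B) = ∫_{B∩F} ‖∇ε‖⁻¹ dμH[1] ≤ v⁻¹ μH[1](B ∩ F) ≤ v⁻¹ μH[1](γ(γ⁻¹B ∩ (−π,π])) ≤ v⁻¹ L λ(γ⁻¹B ∩ (−π,π])` by `LipschitzOnWith.hausdorffMeasure_image_le` and
  `hausdorffMeasure_real`); `kltp_isFiniteMeasure_polar` (sanity corollary).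

No definitions.  What remains of (N1) for the p4 lineage: instantiate `hσ` at the reflected cell `(t′, μ) = (3/10, 0.9596…)` and carry it through the shift; (N3) `hTSL` is
the crux.  Nothing here asserts χ₀'s HS row, a record, a margin, `K₃`, `U₀`, the window or superconductivity; a Kohn–Luttinger `O(U²)` channel statement is not ODLRO;
nothing here proves superconductivity in the Hubbard model.
References: S. Raghu, S. A. Kivelson, D. J. Scalapino, Phys. Rev. B 81 (2010) 224505, §II (6), (8); L. C. Evans, R. F. Gariepy, *Measure Theory and Fine Properties of
Functions* (1992), §2.4 (Hausdorff measure under Lipschitz maps); G. Benfatto, A. Giuliani, V. Mastropietro, Ann. Henri Poincaré 7 (2006), §1 (1.5).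
-/

noncomputable section

-- the tree's namespace `Summit.<Summit>.<Problem>.Theorems` repeats the summit name by design (D-0017)
set_option linter.dupNamespace false

namespace Summit.HubbardSuperconductivity.HubbardSuperconductivity.Theorems

open Real Set Filter MeasureTheory Literature.MathematicalPhysics.QuantumLattice
open scoped Topology ENNReal NNReal

section Window

variable {tp μ : ℝ} (htp : |tp| < 1 / 2) (hμ₁ : -4 - 4 * tp < μ) (hμ₂ : μ < 4 * tp)
include htp hμ₁ hμ₂

/-! ### §1 Polar surjectivity: every point of the Γ-centred Fermi curve is a polar point -/

/-- **The polar chart covers the Fermi curve**: `F(ε_{t′}, μ) ⊆ γ((−π, π])` for `γ = kltpPolar tp μ` on the Γ-window (`|t′| < 1/2`, `−4 − 4t′ < μ < 4t′`): a point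
`k ∈ F` is non-zero (`ε_{t′}(0) = −4 − 4t′ ≠ μ`), its polar angle `θ = arg(k₀ + i k₁) ∈ (−π, π]` and radius `r = ‖k‖` satisfy `IsKltpRadius tp μ θ r`, hence
`r = u_{t′,μ}(θ)` by uniqueness. [folklore] -/
theorem kltp_fermiCurve_subset_image_polar :
    fermiCurve (squareDispersion 1 tp) μ ⊆ kltpPolar tp μ '' Ioc (-π) π := by
  intro k hk
  obtain ⟨hkz, hkε⟩ := hk
  set z : ℂ := ⟨k 0, k 1⟩ with hz
  have hk0 : k ≠ 0 := by
    intro h0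
    have : squareDispersion 1 tp k = -4 - 4 * tp := by
      rw [h0]; simp [squareDispersion]; ring
    linarith [hkε.symm.trans this]
  have hz0 : z ≠ 0 := by
    intro h
    apply hk0
    have hre : k 0 = 0 := by simpa [hz] using congrArg Complex.re h
    have him : k 1 = 0 := by simpa [hz] using congrArg Complex.im h
    ext i; fin_cases i <;> simp [hre, him]
  set θ := Complex.arg z with hθ
  set r := ‖z‖ with hr
  have hrpos : 0 < r := norm_pos_iff.2 hz0
  have hr0 : r ≠ 0 := hrpos.ne'
  have hre : z.re = k 0 := by simp [hz]
  have him : z.im = k 1 := by simp [hz]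
  have hcos : k 0 = r * Real.cos θ := by
    rw [hθ, Complex.cos_arg hz0, ← hr, hre]; field_simp
  have hsin : k 1 = r * Real.sin θ := by
    rw [hθ, Complex.sin_arg, ← hr, him]; field_simp
  have hkeq : k = WithLp.toLp 2 (r • dir θ) := by
    ext i; fin_cases i
    · simpa [dir] using hcos
    · simpa [dir] using hsin
  -- the defining property of the radius
  have hnorm : r * ‖dir θ‖ ≤ π := by
    rw [norm_dir, mul_max_of_nonneg _ _ hrpos.le]
    have h0 := hkz 0
    have h1 := hkz 1
    refine max_le ?_ ?_
    · have : |k 0| ≤ π := abs_le.2 ⟨h0.1, h0.2.le⟩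
      rwa [hcos, abs_mul, abs_of_pos hrpos] at this
    · have : |k 1| ≤ π := abs_le.2 ⟨h1.1, h1.2.le⟩
      rwa [hsin, abs_mul, abs_of_pos hrpos] at this
  have hray : kltpRay tp θ r = μ := by
    rw [← squareDispersion_toLp_smul_dir, ← hkeq]; exact hkε
  have hIs : IsKltpRadius tp μ θ r := ⟨⟨hrpos.le, hnorm⟩, hray⟩
  have hru : r = kltpRadius tp μ θ := kltpRadius_unique htp hμ₁ hμ₂ hIs
  refine ⟨θ, by rw [hθ]; exact Complex.arg_mem_Ioc z, ?_⟩
  rw [hkeq, kltpPolar, hru]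

/-! ### §2 A uniform speed floor on the curve and a Lipschitz bound for the chart (compactness) -/

/-- The transversality function `θ ↦ ∂_tF_{t′}(θ, u(θ))` is continuous. [folklore] -/
theorem continuous_kltpRayDt_polar : Continuous fun θ => kltpRayDt tp θ (kltpRadius tp μ θ) := by
  have hu : Continuous (kltpRadius tp μ) := continuous_kltpRadius htp hμ₁ hμ₂
  unfold kltpRayDt
  fun_prop

/-- **A uniform speed floor on the Γ-centred `t′` Fermi curve** (qualitative, by compactness): `∃ v > 0, ∀ k ∈ F, v ≤ ‖∇ε_{t′}(k)‖`. [folklore] -/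
theorem kltp_exists_speedFloor_polar :
    ∃ v : ℝ, 0 < v ∧ ∀ k ∈ fermiCurve (squareDispersion 1 tp) μ, v ≤ ‖gradient (squareDispersion 1 tp) k‖ := by
  obtain ⟨v, hv, hvle⟩ := isCompact_Icc.exists_forall_le' (continuous_kltpRayDt_polar htp hμ₁ hμ₂).continuousOn
    (a := (0 : ℝ)) (s := Icc (-π) π) (fun θ _ => kltpRayDt_kltpRadius_pos htp hμ₁ hμ₂ θ)
  refine ⟨v, hv, fun k hk => ?_⟩
  obtain ⟨θ, hθ, rfl⟩ := kltp_fermiCurve_subset_image_polar htp hμ₁ hμ₂ hk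
  exact (hvle θ (Ioc_subset_Icc_self hθ)).trans (kltpRayDt_le_norm_gradient tp θ _)

/-- The velocity of the chart is continuous in the angle. [folklore] -/
theorem continuous_kltpPolarVelocity : Continuous (kltpPolarVelocity tp μ) := by
  have hu := continuous_kltpRadius htp hμ₁ hμ₂
  have hu' := continuous_kltpRadiusDeriv htp hμ₁ hμ₂
  have hd : Continuous dir := by
    refine continuous_pi fun i => ?_
    fin_cases i <;> simp [dir] <;> fun_prop
  have hd' : Continuous fun θ : ℝ => (![-Real.sin θ, Real.cos θ] : Fin 2 → ℝ) := by
    refine continuous_pi fun i => ?_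
    fin_cases i <;> simp <;> fun_prop
  unfold kltpPolarVelocity
  exact (PiLp.continuous_toLp 2 _).comp ((hu'.smul hd).add (hu.smul hd'))

/-- **The chart is Lipschitz on `[−π, π]`** (it is `C¹` with velocity bounded on the compact interval; mean value inequality). [folklore] -/
theorem kltp_exists_lipschitzOn_polar : ∃ L : ℝ≥0, LipschitzOnWith L (kltpPolar tp μ) (Icc (-π) π) := by
  have hπ := Real.pi_pos
  obtain ⟨θ₀, -, hmax⟩ := isCompact_Icc.exists_isMaxOn (s := Icc (-π) π) (nonempty_Icc.2 (by linarith))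
    (continuous_kltpPolarVelocity htp hμ₁ hμ₂).norm.continuousOn
  refine ⟨‖kltpPolarVelocity tp μ θ₀‖₊, ?_⟩
  refine (convex_Icc (-π) π).lipschitzOnWith_of_nnnorm_hasDerivWithin_le
    (fun θ _ => (hasDerivAt_kltpPolar htp hμ₁ hμ₂ θ).hasDerivWithinAt) fun θ hθ => ?_
  have h := hmax hθ
  simp only at h
  exact_mod_cast h

/-! ### §3 DOS DOMINATION: `σ[ε_{t′}, μ] ≤ w₁ · γ_* (λ⌞(−π, π])` -/

/-- **The Fermi-curve measure of the `t`–`t′` band is dominated by the push-forward of Lebesgue measure under the polar chart** on the Γ-window (`|t′| < 1/2`,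
`−4 − 4t′ < μ < 4t′`): `∃ w₁ ≥ 0, fermiCurveMeasure (squareDispersion 1 tp) μ ≤ ENNReal.ofReal w₁ • Measure.map (kltpPolar tp μ) (volume.restrict (Ioc (−π) π))` — the `hσ`
input of the chart `L²` route (`kltp_m03_HS_of_chart_TSL` / `klg_memLp_kernel_of_geometry`), here with `w₁ = L/v` (Lipschitz constant of the chart over the speed floor).
[cite: RaghuKivelsonScalapino2010, §II (6), (8)] -/
theorem kltp_fermiCurveMeasure_le_map_polar :
    ∃ w₁ : ℝ, 0 ≤ w₁ ∧ fermiCurveMeasure (squareDispersion 1 tp) μ ≤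
      ENNReal.ofReal w₁ • Measure.map (kltpPolar tp μ) (volume.restrict (Ioc (-π) π)) := by
  obtain ⟨v, hv, hfloor⟩ := kltp_exists_speedFloor_polar htp hμ₁ hμ₂
  obtain ⟨L, hLip⟩ := kltp_exists_lipschitzOn_polar htp hμ₁ hμ₂
  set ε := squareDispersion 1 tp with hε
  set γ := kltpPolar tp μ with hγ
  have hγm : Measurable γ := (continuous_kltpPolar htp hμ₁ hμ₂).measurable
  have hFm : MeasurableSet (fermiCurve ε μ) := measurableSet_fermiCurve (measurable_squareDispersion 1 tp) μ
  refine ⟨(L : ℝ) / v, div_nonneg L.2 hv.le, ?_⟩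
  rw [Measure.le_iff]
  intro B hB
  -- (1) the density is at most `v⁻¹` on the curve
  have h1 : fermiCurveMeasure ε μ B ≤ ENNReal.ofReal v⁻¹ * μH[1] (B ∩ fermiCurve ε μ) := by
    unfold fermiCurveMeasure
    rw [withDensity_apply _ hB, Measure.restrict_restrict hB]
    calc ∫⁻ k in B ∩ fermiCurve ε μ, ENNReal.ofReal (‖gradient ε k‖⁻¹) ∂(μH[1] : Measure Momentum)
        ≤ ∫⁻ _ in B ∩ fermiCurve ε μ, ENNReal.ofReal v⁻¹ ∂(μH[1] : Measure Momentum) := by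
          refine lintegral_mono_ae ?_
          filter_upwards [ae_restrict_mem (hB.inter hFm)] with k hk
          exact ENNReal.ofReal_le_ofReal (inv_anti₀ hv (hfloor k hk.2))
      _ = ENNReal.ofReal v⁻¹ * μH[1] (B ∩ fermiCurve ε μ) := by
          rw [lintegral_const, Measure.restrict_apply MeasurableSet.univ, univ_inter]
  -- (2) the curve part of `B` is the chart image of `γ⁻¹ B ∩ (−π, π]`, of length `≤ L · λ(γ⁻¹ B ∩ (−π, π])`
  have hsub : B ∩ fermiCurve ε μ ⊆ γ '' (γ ⁻¹' B ∩ Ioc (-π) π) := by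
    rintro k ⟨hkB, hkF⟩
    obtain ⟨θ, hθ, rfl⟩ := kltp_fermiCurve_subset_image_polar htp hμ₁ hμ₂ hkF
    exact ⟨θ, ⟨hkB, hθ⟩, rfl⟩
  have h2 : μH[1] (B ∩ fermiCurve ε μ) ≤ (L : ℝ≥0∞) * volume (γ ⁻¹' B ∩ Ioc (-π) π) := by
    have hL' := (hLip.mono (show γ ⁻¹' B ∩ Ioc (-π) π ⊆ Icc (-π) π from
      fun θ hθ => Ioc_subset_Icc_self hθ.2)).hausdorffMeasure_image_le (d := 1) zero_le_one
    rw [ENNReal.rpow_one] at hL'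
    calc μH[1] (B ∩ fermiCurve ε μ) ≤ μH[1] (γ '' (γ ⁻¹' B ∩ Ioc (-π) π)) := measure_mono hsub
      _ ≤ (L : ℝ≥0∞) * μH[1] (γ ⁻¹' B ∩ Ioc (-π) π) := hL'
      _ = (L : ℝ≥0∞) * volume (γ ⁻¹' B ∩ Ioc (-π) π) := by rw [hausdorffMeasure_real]
  -- (3) assemble
  have h3 : (ENNReal.ofReal ((L : ℝ) / v) • Measure.map γ (volume.restrict (Ioc (-π) π))) B =
      ENNReal.ofReal ((L : ℝ) / v) * volume (γ ⁻¹' B ∩ Ioc (-π) π) := by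
    rw [Measure.smul_apply, smul_eq_mul, Measure.map_apply hγm hB, Measure.restrict_apply (hγm hB)]
  rw [h3]
  have hLv : ENNReal.ofReal v⁻¹ * (L : ℝ≥0∞) = ENNReal.ofReal ((L : ℝ) / v) := by
    rw [← ENNReal.ofReal_coe_nnreal, ← ENNReal.ofReal_mul (inv_nonneg.2 hv.le)]
    congr 1
    rw [div_eq_inv_mul]
  calc fermiCurveMeasure ε μ B ≤ ENNReal.ofReal v⁻¹ * μH[1] (B ∩ fermiCurve ε μ) := h1
    _ ≤ ENNReal.ofReal v⁻¹ * ((L : ℝ≥0∞) * volume (γ ⁻¹' B ∩ Ioc (-π) π)) := mul_le_mul' le_rfl h2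
    _ = ENNReal.ofReal ((L : ℝ) / v) * volume (γ ⁻¹' B ∩ Ioc (-π) π) := by rw [← mul_assoc, hLv]

/-- **Finiteness again, from the domination** (sanity: the chart route recovers `IsFiniteMeasure σ` on the Γ-window without the explicit speed floor of p723526).
[folklore] -/
theorem kltp_isFiniteMeasure_polar : IsFiniteMeasure (fermiCurveMeasure (squareDispersion 1 tp) μ) := by
  obtain ⟨w₁, -, hle⟩ := kltp_fermiCurveMeasure_le_map_polar htp hμ₁ hμ₂
  have hγm : Measurable (kltpPolar tp μ) := (continuous_kltpPolar htp hμ₁ hμ₂).measurable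
  refine ⟨lt_of_le_of_lt (hle univ) ?_⟩
  rw [Measure.smul_apply, smul_eq_mul, Measure.map_apply hγm MeasurableSet.univ, preimage_univ,
    Measure.restrict_apply MeasurableSet.univ, univ_inter, Real.volume_Ioc]
  exact ENNReal.mul_lt_top ENNReal.ofReal_lt_top ENNReal.ofReal_lt_top

end Window

end Summit.HubbardSuperconductivity.HubbardSuperconductivity.Theorems

end
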